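import Summits.QuantumFields.YangMills.Theorems.BalabanUVNodesC44IterMhLocality
import Summits.QuantumFields.YangMills.Theorems.BalabanUVNodesC44IterMhRegular
import HarnessLib

/-!
# [B11] (44) AT THE RECORD FOR THE WHOLE FAMILY `C_j`, PER BOND — THE «NESTED NODE-00» GENERAL-LEVEL EDITION OF (ℓa-C)

Cell `pub-ymgap` ∕ `ym-nodeO-ideate`, porter lineage `ymgap-nodeO-port-PTB-1` (gen 8); ★★★ director-ym g22 №578 (2)(ii) ∕ №583 (3) («F10 (nested node-00 family (44), M) is the honest general-Ω
edition for now»; F11 = regional F4′ PARKED); PORT-PLAN-v6 §F10.  `--kind proof --supports stmt-QuantumFields-27238 --as helper`; count-neutral.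
[B11] = [Balaban1985Variational]; [B7] = [Balaban1985Averaging]; [RG1] = [Balaban1987RG1].  PRINT ([B11] (44) p.285): «Q̄_j(L^jηA) = L^jηQ_jA + C_j(L^jηA),
|C_j(L^jηA)| ≤ C₂(L^jη)²|A|²» for `A` with «|A| < ε₂(L^jη)⁻¹, |∇A| < ε₂(L^jη)⁻² on Ω_j» ((43)), on the `Λ_j`-blocks.

SHAPE (★ PT-B g7 (F-β); ★★ DEF-1 `CjOfRecord` ✓p825209, tangency ✓p825314).  The k-level letter `Prop4LetterCAtRecord` reads `C_k` EVERYWHERE (false k-uniformly for a genuine profile);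
print's object is the family `C_j` on `Λ_j`.  Here: the level-`j` member at a bond `c ∈ bondsIn j Y` of a fine region `Y` saturated below `j` (lit's displayed `hY`; unions of `j`-blocks) on whose
bonds the profile has level `≥ j` (`hlev` ⇒ `L^j·‖η_k ev(PA′)‖ ≤ 2‖A′‖` ON `Y`).  By LOCALITY (F9) `C_j^{𝔰𝔩}(A′)(c)` is the chart-minus-linearisation of the SPLICE `X′ = η_k ev(PA′)·𝟙_Y`, globally
`L^{-j}`-small, so F4′ (✓`norm_loopMh_iterMh_expOver_sub_one_le`, ✓`norm_iterMh_expOver_mul_star_sub_one_le`) and F4′-0 (✓`norm_logChart_iterMh_sub_qCplxOp_le_of_linearBound`), generic in the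
level, apply VERBATIM at `j`.  HONEST LABEL «NESTED NODE-00»: the U₀-hypotheses — guard `SmallBelow … j U₀` and the summable loop profile of `Ū^i(U₀)`, `i < j` — are GLOBAL on `T` (print asks
them on the cone of `c` ⊂ Ω_j only); the print-faithful REGIONAL edition needs F4′ re-keyed to `bondsIn i Y` (PORT-PLAN-v6 F11, parked).

WHAT THIS FILE PROVES (0 def; ns `…Theorems.C44IterMh`):
§1 `norm_splice_le`, `trace_splice`, `splice_eqOn`, `L_pow_mul_norm_splice_evLit_le`, `equiv_CslJOfRecord_eq_splice` (locality: `C_j^{𝔰𝔩}(A′)(c) = (G_j X′ − L^j·Q_jX′)(c)`).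
§2 ★★★ `norm_equiv_CslJOfRecord_apply_le_of_loopProfile` — `‖C_j^{𝔰𝔩}(A′)(c)‖ ≤ 1.28·10¹⁶LN·‖A′‖²` on `‖A′‖ < (2·10¹¹LN)⁻¹` (F6's k-free constants);
   ★★ `analyticAt_equiv_CslJOfRecord_apply_of_loopProfile` — `A′ ↦ C_j^{𝔰𝔩}(A′)(c)` is ℂ-analytic at every such `A′`.
§3 `loopProfile_of_regular_below` (print's (14) below `j ≤ k` ⇒ guard + loop profile `ε_i = 9L²α(L^iη_k)²`; F6's conversion), ★★★ `norm_equiv_CslJOfRecord_apply_le_of_regular` ∕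
   ★★ `analyticAt_equiv_CslJOfRecord_apply_of_regular` — §2 from `∀ i < j, PlaqSmall (α(L^iη_k)²) (Ū^iU₀)` with ONE number `0 ≤ α ≤ (1.1·10⁷N)⁻¹`.

HONEST FRAMING.  The F4′∕F5∕F6 engine at level `j` + F9's locality; constants crude; U₀-hypotheses GLOBAL below `j`, NOT print's regional ones; no consumer letter re-typed (def-Y's mould reads
`C_k` only).  (ℓa-C) for a genuine profile in print's sense, (ℓa-H), (KL-H)(KL-N)(KL-C), (R1)∕(R2) OPEN; K0ᴬ ⟨stmt-QuantumFields-27238⟩ NOT closed; K0ᴬ∕K1ᴬ∕K3ᴬ 0∕3; NODE O 0∕1; COUNT 8∕28 ·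
K 1∕4 UNMOVED; finite `𝕋⁴_{L^K}` at fixed ε — NOT continuum ∕ ℝ⁴ ∕ OS; **the Yang–Mills mass gap (Clay) is NOT proved by any of this.**  No `sorry`, `instance`, `notation`, `set_option`; standard axioms.
-/

noncomputable section

open scoped Matrix Matrix.Norms.L2Operator InnerProductSpace ComplexConjugate Topology
open Classical

namespace Summit.QuantumFields.YangMills.Theorems.C44IterMh

open Literature.MathematicalPhysics.QuantumFieldTheory.Balaban1983to89
open Literature.MathematicalPhysics.QuantumFieldTheory.Balaban1983to89.Node00
open T4Continuum BlockAveraging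
open B15AveragingHolomorphic (loopMh iterMh coeField_iter_eq_iterMh)
open B15AveragingAnalytic (analyticAt_iterMh_of_polydisc)
open B10Eq42TorusConstraint (bondsIn mem_bondsIn_iff)
open B10Eq38TorusDomains (toFine)
open B11Eq115Space (NegSup NegSize levWeight JetSup levWeight_apply le_levOf levOf_le)
open B12Lemma4Models (slProj slProj_apply)
open MatrixLog (mlog norm_mlog_le_two_mul)
open ExpMeanLog (expMeanLogSU deltaSU)

section Splice

variable {P : Params} {N : ℕ}

/-- The splice `X·𝟙_Y` is bounded by the sup of `X` on the region. [cite: Balaban1985Variational, (43) p.285 (bookkeeping)] -/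
theorem norm_splice_le {Y : Set (Site P 0)} (X : PBond P 0 → Matrix (Fin N) (Fin N) ℂ) {s : ℝ} (hs : 0 ≤ s)
    (h : ∀ b : PBond P 0, b ∈ bondsIn 0 Y → ‖X b‖ ≤ s) :
    ‖(fun b : PBond P 0 => if b ∈ bondsIn 0 Y then X b else 0)‖ ≤ s := by
  refine (pi_norm_le_iff_of_nonneg hs).2 fun b => ?_
  by_cases hb : b ∈ bondsIn 0 Y
  · rw [if_pos hb]; exact h b hb
  · rw [if_neg hb, norm_zero]; exact hs

/-- The splice of a traceless field is traceless. [cite: Balaban1985Variational, (51) p.286 (bookkeeping)] -/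
theorem trace_splice {Y : Set (Site P 0)} {X : PBond P 0 → Matrix (Fin N) (Fin N) ℂ} (hX : ∀ b, (X b).trace = 0) (b : PBond P 0) :
    ((fun b : PBond P 0 => if b ∈ bondsIn 0 Y then X b else 0) b).trace = 0 := by
  by_cases hb : b ∈ bondsIn 0 Y
  · simp only [if_pos hb]; exact hX b
  · simp only [if_neg hb, Matrix.trace_zero]

/-- The splice agrees with the field on the region. [cite: Balaban1985Variational, (43) p.285 (bookkeeping)] -/
theorem splice_eqOn {Y : Set (Site P 0)} (X : PBond P 0 → Matrix (Fin N) (Fin N) ℂ) :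
    ∀ b : PBond P 0, b ∈ bondsIn 0 Y → X b = (fun b : PBond P 0 => if b ∈ bondsIn 0 Y then X b else 0) b :=
  fun b hb => by simp only [if_pos hb]

end Splice

section Record

variable (F : T4Family) (N : ℕ) [NeZero N] {K : ℕ} (k : ℕ) (Ω : ℕ → Set (Site (F.P K) 0)) (U₀ : GaugeField (F.P K) 0 (SU N))
variable [Fact (0 < (F.L : ℝ))] [Fact (0 < (F.P K).eta k)]

/-- **ON A REGION OF LEVEL `≥ j` THE SPLICED CHART FIELD IS `L^{-j}`-SMALL**: `L^j‖η_k ev(PA′)·𝟙_Y‖ ≤ 2‖A′‖` (the (115) weight on `Y` is `≥ L^jη_k`; `‖π‖ ≤ 2`).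
[cite: Balaban1985Variational, (43) p.285, (115) p.294, (51) p.286] -/
theorem L_pow_mul_norm_splice_evLit_le (j : ℕ) {Y : Set (Site (F.P K) 0)}
    (hlev : ∀ b : PBond (F.P K) 0, b ∈ bondsIn 0 Y → j ≤ bondLevLit F Ω k (bondToLit (F.P K) 0 b)) (A : Space115Lit F N K k Ω U₀) :
    (F.L : ℝ) ^ j * ‖(fun b : PBond (F.P K) 0 => if b ∈ bondsIn 0 Y then
        ((((F.P K).eta k : ℝ) : ℂ) • evLit F N K k Ω U₀ (slProjLit F N K k Ω U₀ A)) b else 0)‖ ≤ 2 * ‖A‖ := by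
  have hη0 : 0 < (F.P K).eta k := Fact.out
  have hL1 : (1 : ℝ) ≤ F.L := by exact_mod_cast (show 1 ≤ F.L by have := F.hL11; omega)
  have hLj : 0 < (F.L : ℝ) ^ j := pow_pos Fact.out j
  rw [mul_comm, ← le_div_iff₀ hLj]
  refine norm_splice_le _ (by positivity) fun b hb => ?_
  rw [le_div_iff₀ hLj, Pi.smul_apply, norm_smul, Complex.norm_real, Real.norm_of_nonneg hη0.le, evLit_slProjLit, evLit_apply]
  have hw := JetSup.weight_mul_norm_apply_le A (bondToLit (F.P K) 0 b)
  rw [levWeight_apply, pow_one] at hw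
  have hπ := norm_slProj_le_two_mul N (JetSup.equiv _ _ _ A (bondToLit (F.P K) 0 b))
  have hLpow : (F.L : ℝ) ^ j ≤ (F.L : ℝ) ^ bondLevLit F Ω k (bondToLit (F.P K) 0 b) := pow_le_pow_right₀ hL1 (hlev b hb)
  have hA0 := norm_nonneg (JetSup.equiv _ _ _ A (bondToLit (F.P K) 0 b))
  calc (F.P K).eta k * ‖slProj N (JetSup.equiv _ _ _ A (bondToLit (F.P K) 0 b))‖ * (F.L : ℝ) ^ j
      ≤ (F.P K).eta k * (2 * ‖JetSup.equiv _ _ _ A (bondToLit (F.P K) 0 b)‖) * (F.L : ℝ) ^ bondLevLit F Ω k (bondToLit (F.P K) 0 b) :=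
        mul_le_mul (mul_le_mul_of_nonneg_left hπ hη0.le) hLpow hLj.le (by positivity)
    _ = 2 * ((F.L : ℝ) ^ bondLevLit F Ω k (bondToLit (F.P K) 0 b) * (F.P K).eta k * ‖JetSup.equiv _ _ _ A (bondToLit (F.P K) 0 b)‖) := by ring
    _ ≤ 2 * ‖A‖ := by linarith

/-- **LOCALITY READ AT THE SPLICE**: under the guard below `j`, for `Y` saturated below `j` and `c ∈ bondsIn j Y`, `C_j^{𝔰𝔩}(A′)(c) = (G_j X′ − L^j·Q_j(U₀)X′)(c)` with `X′ = η_k ev(PA′)·𝟙_Y`,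
`G_j Z = (1∕i)·log(Ū^j_h(e^{iZ}U₀)·Ū^j(U₀)⋆)` (F9 ✓`logOver_iterMh_expOver_apply_congr`, ✓`qCplxOp_apply_congr_of_eqOn`). [cite: Balaban1985Variational, (44) p.285, (20) p.281; Balaban1985Averaging, p.24] -/
theorem equiv_CslJOfRecord_eq_splice (j : ℕ) (hj : j ≤ (F.P K).m + (F.P K).K) (levB : PBond (F.P K) j → ℕ)
    (hU₀ : SmallBelow (avOfRecord F N K) j U₀) {Y : Set (Site (F.P K) 0)}
    (hY : ∀ i, i < j → ∀ s : Site (F.P K) i, toFine i s ∈ Y ↔ toFine (i + 1) (blockOf s) ∈ Y) (A : Space115Lit F N K k Ω U₀)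
    {c : PBond (F.P K) j} (hc : c ∈ bondsIn j Y) :
    NegSup.equiv _ _ (CslJOfRecord F N K k Ω U₀ j levB A) c =
      (logOver (coeField (Averaging.iter (fun j => blockAvg (P := F.P K) (j := j) expMeanLogSU) j U₀))
          (iterMh j (expOver U₀ (fun b : PBond (F.P K) 0 => if b ∈ bondsIn 0 Y then
            ((((F.P K).eta k : ℝ) : ℂ) • evLit F N K k Ω U₀ (slProjLit F N K k Ω U₀ A)) b else 0)))
        - ((F.P K).L : ℂ) ^ j • qCplxOp j U₀ (fun b : PBond (F.P K) 0 => if b ∈ bondsIn 0 Y then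
            ((((F.P K).eta k : ℝ) : ℂ) • evLit F N K k Ω U₀ (slProjLit F N K k Ω U₀ A)) b else 0)) c := by
  set X : PBond (F.P K) 0 → Matrix (Fin N) (Fin N) ℂ := ((((F.P K).eta k : ℝ) : ℂ)) • evLit F N K k Ω U₀ (slProjLit F N K k Ω U₀ A) with hX
  have hXtr : ∀ b, (X b).trace = 0 := fun b => by
    rw [hX, Pi.smul_apply, Matrix.trace_smul, evLit_apply, trace_equiv_slProjLit (F := F) (N := N) (K := K) (k := k) (Ω := Ω) (U₀ := U₀) A _, smul_zero]
  have hX'tr := trace_splice (Y := Y) hXtr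
  have hQ : ((F.L : ℂ) ^ j * (((F.P K).eta k : ℝ) : ℂ)) • qCplxOp j U₀ (evLit F N K k Ω U₀ (slProjLit F N K k Ω U₀ A)) c
      = ((F.P K).L : ℂ) ^ j • qCplxOp j U₀ X c := by
    rw [hX, map_smul, Pi.smul_apply, smul_smul, T4Family.P_L]
  rw [CslJOfRecord_apply, CjOfRecord_apply, hQ, Pi.sub_apply, Pi.smul_apply, logOver_apply,
    ← iterMh_expOver_apply_congr U₀ hj hY (splice_eqOn (Y := Y) X) hc,
    ← qCplxOp_apply_congr_of_eqOn U₀ hj hU₀ hY hXtr hX'tr (splice_eqOn (Y := Y) X) hc]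
  rfl

/-- ★★★ **[B11] (44) FOR THE FAMILY, PER BOND («nested node-00»)**: level `j ≤ m + K`; `U₀` (0.4)-guarded below `j` with loop profile `ε` below `j` (`ε_i ≤ 1∕50`, `N·ε_i ≤ 2`,
`3·10⁵·Σ_{i<j}ε_i ≤ 1∕4`) GLOBAL on `T`; `Y` saturated below `j` with profile level `≥ j` on its bonds; `c ∈ bondsIn j Y`: `‖C_j^{𝔰𝔩}(A′)(c)‖ ≤ 1.28·10¹⁶LN·‖A′‖²` on `‖A′‖ < (2·10¹¹LN)⁻¹`
(F5's engine at level `j` on the splice, read back by locality). [cite: Balaban1985Variational, (44) p.285, (43) p.285, (51)–(53) p.286; Balaban1985Averaging, Proposition 3 p.36, Proposition 7 p.43, p.24; Balaban1987RG1, (0.8) p.253] -/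
theorem norm_equiv_CslJOfRecord_apply_le_of_loopProfile (j : ℕ) (hj : j ≤ (F.P K).m + (F.P K).K) (levB : PBond (F.P K) j → ℕ)
    (hU₀ : SmallBelow (avOfRecord F N K) j U₀) (εs : ℕ → ℝ) (hε0 : ∀ i, 0 ≤ εs i)
    (hε : ∀ i, i < j → ∀ (c : PBond (F.P K) (i + 1)) (a : Idx (F.P K)), ‖loopM (coeField (Averaging.iter (avOfRecord F N K) i U₀)) c a - 1‖ ≤ εs i)
    (hε50 : ∀ i, i < j → εs i ≤ 1 / 50) (hNε : ∀ i, i < j → (N : ℝ) * εs i ≤ 2) (hεsum : 300000 * (Finset.range j).sum εs ≤ 1 / 4)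
    {Y : Set (Site (F.P K) 0)} (hY : ∀ i, i < j → ∀ s : Site (F.P K) i, toFine i s ∈ Y ↔ toFine (i + 1) (blockOf s) ∈ Y)
    (hlev : ∀ b : PBond (F.P K) 0, b ∈ bondsIn 0 Y → j ≤ bondLevLit F Ω k (bondToLit (F.P K) 0 b))
    {c : PBond (F.P K) j} (hc : c ∈ bondsIn j Y) {A : Space115Lit F N K k Ω U₀} (hA : ‖A‖ < 1 / (200000000000 * (F.L : ℝ) * N)) :
    ‖NegSup.equiv _ _ (CslJOfRecord F N K k Ω U₀ j levB A) c‖ ≤ 12800000000000000 * (F.L : ℝ) * N * ‖A‖ ^ 2 := by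
  have hN1 : (1 : ℝ) ≤ N := by exact_mod_cast Nat.one_le_iff_ne_zero.2 (NeZero.ne N)
  have hL12 : (12 : ℝ) ≤ F.L := by exact_mod_cast F.hL11
  have hd4 : ((F.P K).d : ℝ) = 4 := by rw [T4Family.P_d]; norm_num
  have hPL : ((F.P K).L : ℝ) = F.L := by rw [T4Family.P_L]
  have hLN : 0 < (F.L : ℝ) * N := by positivity
  set ρ₀ : ℝ := 1 / (25000000000 * (F.L : ℝ) * N) with hρ₀
  have hρ₀pos : 0 < ρ₀ := by positivity
  have hρ₀LN : ρ₀ * ((F.L : ℝ) * N) = 1 / 25000000000 := by rw [hρ₀]; field_simp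
  have hLN1 : (1 : ℝ) ≤ (F.L : ℝ) * N := by nlinarith
  have hρ₀le : ρ₀ ≤ 1 / 25000000000 :=
    one_div_le_one_div_of_le (by norm_num) (by linarith [mul_le_mul_of_nonneg_left hLN1 (by norm_num : (0:ℝ) ≤ 25000000000)])
  have hc₄' : 1 / (200000000000 * (F.L : ℝ) * N) = ρ₀ / 8 := by rw [hρ₀, div_div]; congr 1; ring
  -- the F4′ package at level `j` for every traceless `Z` with `L^j‖Z‖ < ρ₀`
  have hpack : ∀ Z : PBond (F.P K) 0 → Matrix (Fin N) (Fin N) ℂ, (∀ b, (Z b).trace = 0) → (F.L : ℝ) ^ j * ‖Z‖ < ρ₀ →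
      (∀ i, i < j → ∀ (c : PBond (F.P K) (i + 1)) (a : Idx (F.P K)), ‖loopMh (iterMh i (expOver U₀ Z)) c a - 1‖ ≤ 1 / 2) ∧
      (∀ c : PBond (F.P K) j, ‖iterMh j (expOver U₀ Z) c * star ((Averaging.iter (fun j => blockAvg (P := F.P K) (j := j) expMeanLogSU) j U₀ c : SU N) : Matrix (Fin N) (Fin N) ℂ) - 1‖
        ≤ 8000 * ((F.L : ℝ) ^ j * ‖Z‖)) := by
    intro Z hZ hsmall
    have hZ0 : 0 ≤ (F.L : ℝ) ^ j * ‖Z‖ := by positivity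
    have hNρ : (N : ℝ) * ((F.L : ℝ) ^ j * ‖Z‖) ≤ 1 / 25000000000 := by
      have h1 : (N : ℝ) * ((F.L : ℝ) ^ j * ‖Z‖) ≤ N * ρ₀ := mul_le_mul_of_nonneg_left hsmall.le (by positivity)
      have h2 : (N : ℝ) * ρ₀ ≤ ρ₀ * ((F.L : ℝ) * N) := by nlinarith
      linarith
    have hρ' : 8 * (((F.P K).d : ℝ) + 1) * (((F.P K).L : ℝ) ^ j * (2 * ‖Z‖)) ≤ 1 / 10 ^ 6 := by
      rw [hd4, hPL]; nlinarith
    have hQ' : 2 * (20000000 * (((F.P K).d : ℝ) + 1) ^ 2 * (F.P K).L) * (((F.P K).L : ℝ) ^ j * (2 * ‖Z‖)) + (60000 * (((F.P K).d : ℝ) + 1)) * (Finset.range j).sum εs ≤ 1 / 2 := by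
      rw [hd4, hPL]
      have h1 : (F.L : ℝ) * ((F.L : ℝ) ^ j * ‖Z‖) ≤ F.L * ρ₀ := mul_le_mul_of_nonneg_left hsmall.le (by positivity)
      have h2 : (F.L : ℝ) * ρ₀ ≤ ρ₀ * ((F.L : ℝ) * N) := by nlinarith
      nlinarith
    have hN' : ∀ i, i < j → (N : ℝ) * (56 * (((F.P K).d : ℝ) + 1) * (((F.P K).L : ℝ) ^ j * (2 * ‖Z‖)) + εs i) ≤ 3 := by
      intro i hi; rw [hd4, hPL]; nlinarith [hNε i hi]
    refine ⟨fun i hi c a => norm_loopMh_iterMh_expOver_sub_one_le U₀ j hU₀ εs hε0 hε hε50 hZ hρ' hQ' hN' hi c a, fun c => ?_⟩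
    have h := norm_iterMh_expOver_mul_star_sub_one_le U₀ j hU₀ εs hε0 hε hε50 hZ hρ' hQ' hN' c
    rw [hd4, hPL] at h
    linarith
  have hdiff : ∀ Z : PBond (F.P K) 0 → Matrix (Fin N) (Fin N) ℂ, (∀ b, (Z b).trace = 0) → ((F.P K).L : ℝ) ^ j * ‖Z‖ < ρ₀ →
      DifferentiableAt ℂ (fun Z : PBond (F.P K) 0 → Matrix (Fin N) (Fin N) ℂ =>
        logOver (coeField (Averaging.iter (fun j => blockAvg (P := F.P K) (j := j) expMeanLogSU) j U₀)) (iterMh j (expOver U₀ Z))) Z := by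
    intro Z hZ hsmall
    rw [hPL] at hsmall
    obtain ⟨hp, hl⟩ := hpack Z hZ hsmall
    refine (analyticAt_logChart_iterMh U₀ j (fun i hi c a => lt_of_le_of_lt (hp i hi c a) (by norm_num)) fun c => lt_of_le_of_lt (hl c) ?_).differentiableAt
    nlinarith [hρ₀le]
  have hbound : ∀ Z : PBond (F.P K) 0 → Matrix (Fin N) (Fin N) ℂ, (∀ b, (Z b).trace = 0) → ((F.P K).L : ℝ) ^ j * ‖Z‖ < ρ₀ →
      ‖logOver (coeField (Averaging.iter (fun j => blockAvg (P := F.P K) (j := j) expMeanLogSU) j U₀)) (iterMh j (expOver U₀ Z))‖ ≤ 16000 * (((F.P K).L : ℝ) ^ j * ‖Z‖) := by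
    intro Z hZ hsmall
    rw [hPL] at hsmall ⊢
    obtain ⟨-, hl⟩ := hpack Z hZ hsmall
    have hZ0 : 0 ≤ (F.L : ℝ) ^ j * ‖Z‖ := by positivity
    have h := norm_logOver_le_two_mul U₀ j (by positivity) (by nlinarith [hρ₀le]) hl
    linarith
  have hA0 := norm_nonneg A
  set X : PBond (F.P K) 0 → Matrix (Fin N) (Fin N) ℂ := ((((F.P K).eta k : ℝ) : ℂ)) • evLit F N K k Ω U₀ (slProjLit F N K k Ω U₀ A) with hX
  have hXtr : ∀ b, (X b).trace = 0 := fun b => by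
    rw [hX, Pi.smul_apply, Matrix.trace_smul, evLit_apply, trace_equiv_slProjLit (F := F) (N := N) (K := K) (k := k) (Ω := Ω) (U₀ := U₀) A _, smul_zero]
  have hX'tr := trace_splice (Y := Y) hXtr
  have hX'n : (F.L : ℝ) ^ j * ‖(fun b : PBond (F.P K) 0 => if b ∈ bondsIn 0 Y then X b else 0)‖ ≤ 2 * ‖A‖ := by
    have h := L_pow_mul_norm_splice_evLit_le F N k Ω U₀ j hlev A
    rw [← hX] at h
    exact h
  have hc₄ : 2 * (1 / (200000000000 * (F.L : ℝ) * N)) ≤ ρ₀ / 4 := by rw [hc₄']; linarith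
  have hXρ : 4 * (((F.P K).L : ℝ) ^ j * ‖(fun b : PBond (F.P K) 0 => if b ∈ bondsIn 0 Y then X b else 0)‖) ≤ ρ₀ := by rw [hPL]; linarith
  have hmain := norm_logChart_iterMh_sub_qCplxOp_le_of_linearBound U₀ hU₀ (by norm_num : (0:ℝ) ≤ 16000) hdiff hbound hX'tr hXρ
  rw [hPL] at hmain
  have hC : 8 * 16000 / ρ₀ * ((F.L : ℝ) ^ j * ‖(fun b : PBond (F.P K) 0 => if b ∈ bondsIn 0 Y then X b else 0)‖) ^ 2
      ≤ 12800000000000000 * (F.L : ℝ) * N * ‖A‖ ^ 2 := by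
    have h1 : ((F.L : ℝ) ^ j * ‖(fun b : PBond (F.P K) 0 => if b ∈ bondsIn 0 Y then X b else 0)‖) ^ 2 ≤ (2 * ‖A‖) ^ 2 :=
      pow_le_pow_left₀ (by positivity) hX'n 2
    have h2 : 8 * 16000 / ρ₀ = 512000 * (25000000000 * (F.L : ℝ) * N) / 4 := by rw [hρ₀]; field_simp; ring
    rw [h2]
    nlinarith [mul_le_mul_of_nonneg_left h1 (by positivity : (0:ℝ) ≤ 512000 * (25000000000 * (F.L : ℝ) * N) / 4)]
  have heq := equiv_CslJOfRecord_eq_splice F N k Ω U₀ j hj levB hU₀ hY A hc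
  rw [← hX] at heq
  rw [heq]
  exact (norm_le_pi_norm _ c).trans (hmain.trans hC)

/-- ★★ **THE COMPONENTS OF `C_j^{𝔰𝔩}` ARE ℂ-ANALYTIC ON THE BALL** (same hypotheses): `A′ ↦ C_j^{𝔰𝔩}(A′)(c)` is ℂ-analytic at every `‖A′‖ < c₄` — Sect. G's analytic chart-minus-
linearisation (✓`analyticAt_logChart_iterMh` at level `j`) composed with the LINEAR splice. [cite: Balaban1985Variational, Sect. G p.307, (44) p.285, (51)–(53) p.286; Balaban1987RG1, (0.4) p.253] -/
theorem analyticAt_equiv_CslJOfRecord_apply_of_loopProfile (j : ℕ) (hj : j ≤ (F.P K).m + (F.P K).K) (levB : PBond (F.P K) j → ℕ)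
    (hU₀ : SmallBelow (avOfRecord F N K) j U₀) (εs : ℕ → ℝ) (hε0 : ∀ i, 0 ≤ εs i)
    (hε : ∀ i, i < j → ∀ (c : PBond (F.P K) (i + 1)) (a : Idx (F.P K)), ‖loopM (coeField (Averaging.iter (avOfRecord F N K) i U₀)) c a - 1‖ ≤ εs i)
    (hε50 : ∀ i, i < j → εs i ≤ 1 / 50) (hNε : ∀ i, i < j → (N : ℝ) * εs i ≤ 2) (hεsum : 300000 * (Finset.range j).sum εs ≤ 1 / 4)
    {Y : Set (Site (F.P K) 0)} (hY : ∀ i, i < j → ∀ s : Site (F.P K) i, toFine i s ∈ Y ↔ toFine (i + 1) (blockOf s) ∈ Y)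
    (hlev : ∀ b : PBond (F.P K) 0, b ∈ bondsIn 0 Y → j ≤ bondLevLit F Ω k (bondToLit (F.P K) 0 b))
    {c : PBond (F.P K) j} (hc : c ∈ bondsIn j Y) {A : Space115Lit F N K k Ω U₀} (hA : ‖A‖ < 1 / (200000000000 * (F.L : ℝ) * N)) :
    AnalyticAt ℂ (fun B : Space115Lit F N K k Ω U₀ => NegSup.equiv _ _ (CslJOfRecord F N K k Ω U₀ j levB B) c) A := by
  have hN1 : (1 : ℝ) ≤ N := by exact_mod_cast Nat.one_le_iff_ne_zero.2 (NeZero.ne N)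
  have hL12 : (12 : ℝ) ≤ F.L := by exact_mod_cast F.hL11
  have hd4 : ((F.P K).d : ℝ) = 4 := by rw [T4Family.P_d]; norm_num
  have hPL : ((F.P K).L : ℝ) = F.L := by rw [T4Family.P_L]
  have hLN : 0 < (F.L : ℝ) * N := by positivity
  set ρ₀ : ℝ := 1 / (25000000000 * (F.L : ℝ) * N) with hρ₀
  have hρ₀pos : 0 < ρ₀ := by positivity
  have hρ₀LN : ρ₀ * ((F.L : ℝ) * N) = 1 / 25000000000 := by rw [hρ₀]; field_simp
  have hLN1 : (1 : ℝ) ≤ (F.L : ℝ) * N := by nlinarith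
  have hρ₀le : ρ₀ ≤ 1 / 25000000000 :=
    one_div_le_one_div_of_le (by norm_num) (by linarith [mul_le_mul_of_nonneg_left hLN1 (by norm_num : (0:ℝ) ≤ 25000000000)])
  have hc₄' : 1 / (200000000000 * (F.L : ℝ) * N) = ρ₀ / 8 := by rw [hρ₀, div_div]; congr 1; ring
  set S : Space115Lit F N K k Ω U₀ → PBond (F.P K) 0 → Matrix (Fin N) (Fin N) ℂ := fun B b =>
    if b ∈ bondsIn 0 Y then ((((F.P K).eta k : ℝ) : ℂ) • evLit F N K k Ω U₀ (slProjLit F N K k Ω U₀ B)) b else 0 with hS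
  have hSan : ∀ B, AnalyticAt ℂ S B := by
    intro B
    have hev : AnalyticAt ℂ (fun B : Space115Lit F N K k Ω U₀ => (((F.P K).eta k : ℝ) : ℂ) • evLit F N K k Ω U₀ (slProjLit F N K k Ω U₀ B)) B :=
      (((LinearMap.toContinuousLinearMap (evLit F N K k Ω U₀)).analyticAt _).comp ((slProjLit F N K k Ω U₀).analyticAt B)).fun_const_smul
    refine analyticAt_pi_iff.2 fun b => ?_
    by_cases hb : b ∈ bondsIn 0 Y
    · simp only [if_pos hb]
      exact ((ContinuousLinearMap.proj (R := ℂ) b : (PBond (F.P K) 0 → Matrix (Fin N) (Fin N) ℂ) →L[ℂ] Matrix (Fin N) (Fin N) ℂ).analyticAt _).comp hev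
    · simp only [if_neg hb]
      exact analyticAt_const
  have hStr : ∀ B b, (S B b).trace = 0 := by
    intro B b
    have hXtr : ∀ b, (((((F.P K).eta k : ℝ) : ℂ) • evLit F N K k Ω U₀ (slProjLit F N K k Ω U₀ B)) b).trace = 0 := fun b => by
      rw [Pi.smul_apply, Matrix.trace_smul, evLit_apply, trace_equiv_slProjLit (F := F) (N := N) (K := K) (k := k) (Ω := Ω) (U₀ := U₀) B _, smul_zero]
    exact trace_splice (Y := Y) hXtr b
  have hSn : (F.L : ℝ) ^ j * ‖S A‖ ≤ 2 * ‖A‖ := L_pow_mul_norm_splice_evLit_le F N k Ω U₀ j hlev A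
  have hsmall : (F.L : ℝ) ^ j * ‖S A‖ < ρ₀ := by
    have : 2 * (1 / (200000000000 * (F.L : ℝ) * N)) ≤ ρ₀ := by rw [hc₄']; linarith
    linarith
  have hS0 : 0 ≤ (F.L : ℝ) ^ j * ‖S A‖ := by positivity
  have hNρ : (N : ℝ) * ((F.L : ℝ) ^ j * ‖S A‖) ≤ 1 / 25000000000 := by
    have h1 : (N : ℝ) * ((F.L : ℝ) ^ j * ‖S A‖) ≤ N * ρ₀ := mul_le_mul_of_nonneg_left hsmall.le (by positivity)
    have h2 : (N : ℝ) * ρ₀ ≤ ρ₀ * ((F.L : ℝ) * N) := by nlinarith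
    linarith
  have hρ' : 8 * (((F.P K).d : ℝ) + 1) * (((F.P K).L : ℝ) ^ j * (2 * ‖S A‖)) ≤ 1 / 10 ^ 6 := by
    rw [hd4, hPL]; nlinarith
  have hQ' : 2 * (20000000 * (((F.P K).d : ℝ) + 1) ^ 2 * (F.P K).L) * (((F.P K).L : ℝ) ^ j * (2 * ‖S A‖)) + (60000 * (((F.P K).d : ℝ) + 1)) * (Finset.range j).sum εs ≤ 1 / 2 := by
    rw [hd4, hPL]
    have h1 : (F.L : ℝ) * ((F.L : ℝ) ^ j * ‖S A‖) ≤ F.L * ρ₀ := mul_le_mul_of_nonneg_left hsmall.le (by positivity)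
    have h2 : (F.L : ℝ) * ρ₀ ≤ ρ₀ * ((F.L : ℝ) * N) := by nlinarith
    nlinarith
  have hN' : ∀ i, i < j → (N : ℝ) * (56 * (((F.P K).d : ℝ) + 1) * (((F.P K).L : ℝ) ^ j * (2 * ‖S A‖)) + εs i) ≤ 3 := by
    intro i hi; rw [hd4, hPL]; nlinarith [hNε i hi]
  have hp : ∀ i, i < j → ∀ (c : PBond (F.P K) (i + 1)) (a : Idx (F.P K)), ‖loopMh (iterMh i (expOver U₀ (S A))) c a - 1‖ < 1 :=
    fun i hi c a => lt_of_le_of_lt (norm_loopMh_iterMh_expOver_sub_one_le U₀ j hU₀ εs hε0 hε hε50 (hStr A) hρ' hQ' hN' hi c a) (by norm_num)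
  have hl : ∀ c : PBond (F.P K) j, ‖iterMh j (expOver U₀ (S A)) c * star ((Averaging.iter (fun j => blockAvg (P := F.P K) (j := j) expMeanLogSU) j U₀ c : SU N) :
      Matrix (Fin N) (Fin N) ℂ) - 1‖ < 1 := by
    intro c
    have h := norm_iterMh_expOver_mul_star_sub_one_le U₀ j hU₀ εs hε0 hε hε50 (hStr A) hρ' hQ' hN' c
    rw [hd4, hPL] at h
    nlinarith [hρ₀le]
  have hG : AnalyticAt ℂ (fun Z : PBond (F.P K) 0 → Matrix (Fin N) (Fin N) ℂ =>
      logOver (coeField (Averaging.iter (fun j => blockAvg (P := F.P K) (j := j) expMeanLogSU) j U₀)) (iterMh j (expOver U₀ Z))) (S A) :=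
    analyticAt_logChart_iterMh U₀ j hp hl
  have hlin : AnalyticAt ℂ (fun Z : PBond (F.P K) 0 → Matrix (Fin N) (Fin N) ℂ => ((F.P K).L : ℂ) ^ j • qCplxOp j U₀ Z) (S A) :=
    ((LinearMap.toContinuousLinearMap (qCplxOp j U₀)).analyticAt _).fun_const_smul
  have hout : AnalyticAt ℂ (fun Z : PBond (F.P K) 0 → Matrix (Fin N) (Fin N) ℂ =>
      (logOver (coeField (Averaging.iter (fun j => blockAvg (P := F.P K) (j := j) expMeanLogSU) j U₀)) (iterMh j (expOver U₀ Z))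
        - ((F.P K).L : ℂ) ^ j • qCplxOp j U₀ Z) c) (S A) :=
    ((ContinuousLinearMap.proj (R := ℂ) c : (PBond (F.P K) j → Matrix (Fin N) (Fin N) ℂ) →L[ℂ] Matrix (Fin N) (Fin N) ℂ).analyticAt _).comp (hG.sub hlin)
  have hfun : (fun B : Space115Lit F N K k Ω U₀ => NegSup.equiv _ _ (CslJOfRecord F N K k Ω U₀ j levB B) c)
      = (fun Z : PBond (F.P K) 0 → Matrix (Fin N) (Fin N) ℂ =>
          (logOver (coeField (Averaging.iter (fun j => blockAvg (P := F.P K) (j := j) expMeanLogSU) j U₀)) (iterMh j (expOver U₀ Z))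
            - ((F.P K).L : ℂ) ^ j • qCplxOp j U₀ Z) c) ∘ S := by
    funext B
    exact equiv_CslJOfRecord_eq_splice F N k Ω U₀ j hj levB hU₀ hY B hc
  rw [hfun]
  exact hout.comp (hSan A)

omit [Fact (0 < (F.L : ℝ))] in
/-- **PRINT's (14) BELOW `j ≤ k` GIVES THE GUARD AND THE LOOP PROFILE `ε_i = 9L²α(L^iη_k)²`** with `ε_i ≤ 9α ≤ 1∕50`, `N·ε_i ≤ 2`, `3·10⁵·Σ_{i<j}ε_i ≤ 1∕4` for `0 ≤ α ≤ (1.1·10⁷N)⁻¹`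
(F6's conversion ✓`smallBelow_of_plaqProfile`, ✓`norm_loopM_coeField_sub_one_le_of_plaqSmall`, ✓`sum_range_weightSq_le`, read below `j`). [cite: Balaban1985Variational, (14) p.280, (2) p.278; Balaban1987RG1, (0.4) p.253, (0.18) p.255] -/
theorem loopProfile_of_regular_below [Fact (0 < c0Rec F K k)] {j : ℕ} (hjk : j ≤ k) {α : ℝ} (hα0 : 0 ≤ α) (hα : α * (11000000 * N) ≤ 1)
    (hreg : ∀ i, i < j → PlaqSmall (α * ((F.L : ℝ) ^ i * (F.P K).eta k) ^ 2) (Averaging.iter (avOfRecord F N K) i U₀)) :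
    SmallBelow (avOfRecord F N K) j U₀ ∧
    (∀ i, 0 ≤ 9 * (F.L : ℝ) ^ 2 * (α * ((F.L : ℝ) ^ i * (F.P K).eta k) ^ 2)) ∧
    (∀ i, i < j → ∀ (c : PBond (F.P K) (i + 1)) (a : Idx (F.P K)),
      ‖loopM (coeField (Averaging.iter (avOfRecord F N K) i U₀)) c a - 1‖ ≤ 9 * (F.L : ℝ) ^ 2 * (α * ((F.L : ℝ) ^ i * (F.P K).eta k) ^ 2)) ∧
    (∀ i, i < j → 9 * (F.L : ℝ) ^ 2 * (α * ((F.L : ℝ) ^ i * (F.P K).eta k) ^ 2) ≤ 1 / 50) ∧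
    (∀ i, i < j → (N : ℝ) * (9 * (F.L : ℝ) ^ 2 * (α * ((F.L : ℝ) ^ i * (F.P K).eta k) ^ 2)) ≤ 2) ∧
    300000 * (Finset.range j).sum (fun i => 9 * (F.L : ℝ) ^ 2 * (α * ((F.L : ℝ) ^ i * (F.P K).eta k) ^ 2)) ≤ 1 / 4 := by
  have hN1 : (1 : ℝ) ≤ N := by exact_mod_cast Nat.one_le_iff_ne_zero.2 (NeZero.ne N)
  have hL12 : (12 : ℝ) ≤ F.L := by exact_mod_cast F.hL11
  have hL1 : (1 : ℝ) ≤ F.L := by linarith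
  have hη0 : 0 < (F.P K).eta k := Fact.out
  have hw1 : (F.L : ℝ) ^ k * (F.P K).eta k = 1 := L_pow_mul_eta_real F k
  have hαs : α ≤ 1 / 11000000 := by
    rw [le_div_iff₀ (by norm_num)]
    nlinarith [mul_le_mul_of_nonneg_left hN1 (by positivity : (0 : ℝ) ≤ α * 11000000)]
  have hαN : α * N ≤ 1 / 11000000 := by
    rw [le_div_iff₀ (by norm_num)]
    linarith
  have hS : ((((F.P K).d + 2) * (F.P K).L : ℕ) : ℝ) ^ 2 / 4 = 9 * (F.L : ℝ) ^ 2 := by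
    rw [T4Family.P_d, T4Family.P_L]; push_cast; ring
  have hwj : ∀ i, i < j → (F.L : ℝ) ^ 2 * ((F.L : ℝ) ^ i * (F.P K).eta k) ^ 2 ≤ 1 := by
    intro i hi
    have h1 : (F.L : ℝ) ^ (i + 1) * (F.P K).eta k ≤ 1 := by
      rw [← hw1]; exact mul_le_mul_of_nonneg_right (pow_le_pow_right₀ hL1 (by omega)) hη0.le
    have h0 : 0 ≤ (F.L : ℝ) ^ (i + 1) * (F.P K).eta k := by positivity
    calc (F.L : ℝ) ^ 2 * ((F.L : ℝ) ^ i * (F.P K).eta k) ^ 2 = ((F.L : ℝ) ^ (i + 1) * (F.P K).eta k) ^ 2 := by ring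
      _ ≤ 1 := pow_le_one₀ h0 h1
  have hδ0 : ∀ i, 0 ≤ α * ((F.L : ℝ) ^ i * (F.P K).eta k) ^ 2 := fun i => mul_nonneg hα0 (sq_nonneg _)
  have hεj : ∀ i, i < j → 9 * (F.L : ℝ) ^ 2 * (α * ((F.L : ℝ) ^ i * (F.P K).eta k) ^ 2) ≤ 9 * α := by
    intro i hi
    have h := mul_le_mul_of_nonneg_left (hwj i hi) (mul_nonneg (by norm_num : (0 : ℝ) ≤ 9) hα0)
    calc 9 * (F.L : ℝ) ^ 2 * (α * ((F.L : ℝ) ^ i * (F.P K).eta k) ^ 2) = 9 * α * ((F.L : ℝ) ^ 2 * ((F.L : ℝ) ^ i * (F.P K).eta k) ^ 2) := by ring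
      _ ≤ 9 * α * 1 := h
      _ = 9 * α := mul_one _
  have hguard : ∀ i, i < j → ((((F.P K).d + 2) * (F.P K).L : ℕ) : ℝ) ^ 2 / 4 * (α * ((F.L : ℝ) ^ i * (F.P K).eta k) ^ 2) < deltaSU (Fin N) := by
    intro i hi
    rw [hS, ExpMeanLog.deltaSU, Fintype.card_fin]
    refine lt_of_le_of_lt (hεj i hi) (lt_min (by linarith) ?_)
    rw [lt_div_iff₀ (by positivity)]
    nlinarith [Real.pi_gt_three]
  have hsum : (Finset.range j).sum (fun i => 9 * (F.L : ℝ) ^ 2 * (α * ((F.L : ℝ) ^ i * (F.P K).eta k) ^ 2)) ≤ 9 * α * (144 / 143) := by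
    have hterm : ∀ i, 9 * (F.L : ℝ) ^ 2 * (α * ((F.L : ℝ) ^ i * (F.P K).eta k) ^ 2) = 9 * α * ((F.L : ℝ) ^ 2 * ((F.L : ℝ) ^ i * (F.P K).eta k) ^ 2) := by
      intro i; ring
    simp_rw [hterm]
    rw [← Finset.mul_sum]
    have hpos : 0 < (F.L : ℝ) ^ 2 - 1 := by nlinarith
    have hratio : (F.L : ℝ) ^ 2 / ((F.L : ℝ) ^ 2 - 1) ≤ 144 / 143 := by
      rw [div_le_div_iff₀ hpos (by norm_num)]
      nlinarith
    have hmono : (Finset.range j).sum (fun i => (F.L : ℝ) ^ 2 * ((F.L : ℝ) ^ i * (F.P K).eta k) ^ 2)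
        ≤ (Finset.range k).sum (fun i => (F.L : ℝ) ^ 2 * ((F.L : ℝ) ^ i * (F.P K).eta k) ^ 2) :=
      Finset.sum_le_sum_of_subset_of_nonneg (Finset.range_mono hjk) fun i _ _ => by positivity
    exact mul_le_mul_of_nonneg_left ((hmono.trans (sum_range_weightSq_le F k)).trans hratio) (mul_nonneg (by norm_num) hα0)
  refine ⟨smallBelow_of_plaqProfile (avOfRecord F N K) j U₀ hδ0 hreg hguard, fun i => mul_nonneg (by positivity) (hδ0 i), fun i hi c a => ?_,
    fun i hi => (hεj i hi).trans (by linarith), fun i hi => ?_, by linarith⟩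
  · have h := norm_loopM_coeField_sub_one_le_of_plaqSmall (hδ0 i) (hreg i hi) c a
    rw [hS] at h
    exact h
  · calc (N : ℝ) * (9 * (F.L : ℝ) ^ 2 * (α * ((F.L : ℝ) ^ i * (F.P K).eta k) ^ 2)) ≤ N * (9 * α) := mul_le_mul_of_nonneg_left (hεj i hi) (by positivity)
      _ = 9 * (α * N) := by ring
      _ ≤ 2 := by linarith

/-- ★★★ **[B11] (44) FOR THE FAMILY, PER BOND, FROM PRINT's REGULARITY (14) BELOW `j ≤ k`** («nested node-00»: `∀ i < j, PlaqSmall (α(L^iη_k)²) (Ū^iU₀)` on all of `T`, ONE number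
`0 ≤ α ≤ (1.1·10⁷N)⁻¹`; `Y` saturated below `j` with profile level `≥ j` on its bonds; `c ∈ bondsIn j Y`): `‖C_j^{𝔰𝔩}(A′)(c)‖ ≤ 1.28·10¹⁶LN·‖A′‖²` on `‖A′‖ < (2·10¹¹LN)⁻¹`.
[cite: Balaban1985Variational, (44) p.285, (14) p.280, (43) p.285; Balaban1985Averaging, Proposition 3 p.36, p.24; Balaban1987RG1, (0.8) p.253] -/
theorem norm_equiv_CslJOfRecord_apply_le_of_regular [Fact (0 < c0Rec F K k)] {j : ℕ} (hjk : j ≤ k) (hj : j ≤ (F.P K).m + (F.P K).K)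
    (levB : PBond (F.P K) j → ℕ) {α : ℝ} (hα0 : 0 ≤ α) (hα : α * (11000000 * N) ≤ 1)
    (hreg : ∀ i, i < j → PlaqSmall (α * ((F.L : ℝ) ^ i * (F.P K).eta k) ^ 2) (Averaging.iter (avOfRecord F N K) i U₀))
    {Y : Set (Site (F.P K) 0)} (hY : ∀ i, i < j → ∀ s : Site (F.P K) i, toFine i s ∈ Y ↔ toFine (i + 1) (blockOf s) ∈ Y)
    (hlev : ∀ b : PBond (F.P K) 0, b ∈ bondsIn 0 Y → j ≤ bondLevLit F Ω k (bondToLit (F.P K) 0 b))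
    {c : PBond (F.P K) j} (hc : c ∈ bondsIn j Y) {A : Space115Lit F N K k Ω U₀} (hA : ‖A‖ < 1 / (200000000000 * (F.L : ℝ) * N)) :
    ‖NegSup.equiv _ _ (CslJOfRecord F N K k Ω U₀ j levB A) c‖ ≤ 12800000000000000 * (F.L : ℝ) * N * ‖A‖ ^ 2 := by
  obtain ⟨hU₀, hε0, hε, hε50, hNε, hεsum⟩ := loopProfile_of_regular_below F N k U₀ hjk hα0 hα hreg
  exact norm_equiv_CslJOfRecord_apply_le_of_loopProfile F N k Ω U₀ j hj levB hU₀ _ hε0 hε hε50 hNε hεsum hY hlev hc hA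

/-- ★★ **ANALYTICITY OF THE COMPONENTS FROM (14) BELOW `j ≤ k`** (same hypotheses): `A′ ↦ C_j^{𝔰𝔩}(A′)(c)` is ℂ-analytic at every `‖A′‖ < (2·10¹¹LN)⁻¹`.
[cite: Balaban1985Variational, Sect. G p.307, (44) p.285, (14) p.280; Balaban1987RG1, (0.4) p.253] -/
theorem analyticAt_equiv_CslJOfRecord_apply_of_regular [Fact (0 < c0Rec F K k)] {j : ℕ} (hjk : j ≤ k) (hj : j ≤ (F.P K).m + (F.P K).K)
    (levB : PBond (F.P K) j → ℕ) {α : ℝ} (hα0 : 0 ≤ α) (hα : α * (11000000 * N) ≤ 1)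
    (hreg : ∀ i, i < j → PlaqSmall (α * ((F.L : ℝ) ^ i * (F.P K).eta k) ^ 2) (Averaging.iter (avOfRecord F N K) i U₀))
    {Y : Set (Site (F.P K) 0)} (hY : ∀ i, i < j → ∀ s : Site (F.P K) i, toFine i s ∈ Y ↔ toFine (i + 1) (blockOf s) ∈ Y)
    (hlev : ∀ b : PBond (F.P K) 0, b ∈ bondsIn 0 Y → j ≤ bondLevLit F Ω k (bondToLit (F.P K) 0 b))
    {c : PBond (F.P K) j} (hc : c ∈ bondsIn j Y) {A : Space115Lit F N K k Ω U₀} (hA : ‖A‖ < 1 / (200000000000 * (F.L : ℝ) * N)) :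
    AnalyticAt ℂ (fun B : Space115Lit F N K k Ω U₀ => NegSup.equiv _ _ (CslJOfRecord F N K k Ω U₀ j levB B) c) A := by
  obtain ⟨hU₀, hε0, hε, hε50, hNε, hεsum⟩ := loopProfile_of_regular_below F N k U₀ hjk hα0 hα hreg
  exact analyticAt_equiv_CslJOfRecord_apply_of_loopProfile F N k Ω U₀ j hj levB hU₀ _ hε0 hε hε50 hNε hεsum hY hlev hc hA

end Record

end Summit.QuantumFields.YangMills.Theorems.C44IterMh

end
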